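import Summits.AtomisticToContinuum.FouriersLaw.Theorems.JunctionLocalityHarmonicCalibration
import Literature.Barriers.AtomisticToContinuum.FixedLengthNoConductivityControl
import Literature.Barriers.AtomisticToContinuum.LowTemperatureWeakAnharmonicity
import Summits.AtomisticToContinuum.FouriersLaw.Theses.BondHeatUncertainty
import Summits.AtomisticToContinuum.FouriersLaw.Theses.PuiseuxTransferLedger

/-!
# Disproof of `NonBallistic` (crux stmt-AtomisticToContinuum-9127) — standing adversary, gen 2

Crux (route `JunctionLocality`, shared verbatim with `PuiseuxTransferLedger`; sub-problem `FouriersLaw`):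
under weak-NESS uniqueness for `pinnedChain ω₂ lam β γ` (all four parameters `> 0`), for every
steady-state family `μ`, every `T > 0` and every response sequence `D` with
`D N = lim_{δ→0,δ≠0} totalCurrent(μ N (T+δ/2) (T-δ/2))/δ`:
`∀ ε > 0, ∀ N₀, ∃ N ≥ N₀, D N ≤ ε (N - 1)` — the conductance `G_N := D_N/(N-1)` is not bounded away
from `0` (`liminf_N G_N = 0`).

## Findings (all theorems below are sorry-free unless marked NEAR-MISS)

* VERDICT SO FAR: no kill. The statement is a NECESSARY CONDITION of the conjunct:
  `not_fouriersLaw_of_not_nonBallistic : ¬ NonBallistic → ¬ FouriersLaw` (through the catalogued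
  barrier predicate `HasBoundedResponse`, `nonBallistic_of_forall_hasBoundedResponse`). So an
  unconditional refutation of this crux is a refutation of `FouriersLaw` for the pinned quartic
  chain — i.e. a proof of BALLISTIC transport (`not_nonBallistic_iff`: a conductance floor
  `G_N > ε` for all large `N` at some admissible parameter point, WITH weak-NESS uniqueness proved
  there). Nothing in print or in the tree points that way (BLR 2000 §10 item 1, Aoki–Kusnezov:
  normal transport numerically); the weak-uniqueness hypothesis alone (`NessUnique`, open item) is
  beyond reach, so even a hypothetical ballistic mechanism could only be filed modulo `NessUnique`.
* LOAD-BEARING HYPOTHESIS = anharmonicity. With `0 < lam, 0 < β` relaxed to `0 ≤ lam, 0 ≤ β` the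
  statement is FALSE at the harmonic member `lam = β = 0` (`nonBallistic_false_without_anharmonicity`,
  from the proved support item `HarmonicCalibration`: `R_N = (N-1)/D_N ≤ B`, so `G_N ≥ 1/B`), once
  the weak-uniqueness hypothesis is also dropped; keeping the crux's exact shape, the harmonic
  member kills it modulo weak-NESS uniqueness of the HARMONIC chain
  (`nonBallisticClosedRange_false_of_harmonicNessUnique`). Any proof must use `lam > 0 ∨ β > 0`.
* NOT load-bearing (information for provers): the weak-uniqueness hypothesis is not used by either
  known path to the conclusion (`BondHeatUncertainty.transferToNonBallistic_proof` passes it through;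
  the necessity argument ignores it); `ω₂ > 0` (pinning) is irrelevant to THIS crux physically
  (unpinned FPU-β is anomalous, `G_N ~ N^{α-1} → 0`, still non-ballistic) — it matters for
  `ConductanceLowerBound`/finiteness, not here; `γ > 0` enters only through existence of `D`.
* DEGENERATE CASES: `D 0 = D 1 = 0` are forced (`response_eq_zero_of_le_one`), so for `N₀ ≤ 1`
  the conclusion holds with the free witness `N = 1`; the content starts at `N₀ ≥ 2`.
  If some response limit fails to exist the crux is vacuous along that family (hypothesis on `D`).
* EXACT SHAPE OF A KILL GIVEN (A): under `SuperadditiveResistance` with constant `C` and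
  `D_N > 0`, the conclusion is EQUIVALENT to one finite certificate `R_{N₀} > C`
  (`notBallisticSeq_iff_exists_certificate`) and to `G_N → 0` outright
  (`notBallisticSeq_iff_conductance_tendsto_zero`, via the dichotomy `conductance_dichotomy`:
  bounded resistance `sup_{N≥2} R_N ≤ C` OR `G_N → 0`). So, on the route's own terms, a disproof
  must exhibit UNIFORMLY BOUNDED RESISTANCE — the harmonic signature (`HarmonicCalibration`:
  `R_N ≤ B`).
* WHY A MAZUR-TYPE KILL IS EMPTY: the bond currents are ODD and the Hamiltonian EVEN under momentum
  reversal (`bondCurrent_momentumReversal`, `hamiltonian_momentumReversal`), so in every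
  reversal-symmetric state the static overlap of the total current with ANY function of `H` — the
  only local conserved quantity known for `lam, β > 0` — vanishes
  (`integral_totalCurrent_mul_hamiltonian_eq_zero`); the Mazur numerator that makes integrable /
  harmonic chains ballistic is zero here (cf. `MazurBoundBallisticNarrow.starProjection_eq_zero_of_reversing`).
* SCALING CONJUGACY (§7): the amplitude scaling of `LowTemperatureWeakAnharmonicity.lean`
  leaves difference quotients, response sequences and weak uniqueness invariant, so
  `NonBallistic ↔ ∀ (ω₂, lam, β, γ) > 0, NonBallisticAtTemp ω₂ lam β γ 1`
  (`nonBallistic_iff_unit_temperature`; also `nonBallistic_iff_unit_pinning`): the temperature is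
  the anharmonic coupling in disguise, `N₀(ε; lam, β, T) = N₀(ε; lam T, β T, 1)`, the `T ↓ 0`
  limit point is the harmonic member where the conclusion FAILS (§4) — so a `T`-uniform (or
  coupling-uniform) witness length is not to be expected, and a finite certificate (§5) at one
  parameter point settles one hyperbola `{lam T = c₁, β T = c₂}` only.
* Gen-1 history (cdisprove v1–v3; that evidence store is not mounted in this jail, findings as
  relayed by the r1 triage panel): necessity `FouriersLaw → NonBallistic`, harmonic corner false,
  scaling conjugacy. This gen-2 file re-proves all three in the present namespace (§3, §4, §7) and
  adds the degenerate lengths (§2), the kill shape (§3), the certificate dichotomy (§5) and the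
  parity obstruction (§6).

## Targets
None yet (payload `targets` / `stuck_stubs` empty at gen 2, cycle 1).
-/

noncomputable section

open MeasureTheory Filter Topology Set

namespace Summit.AtomisticToContinuum.FouriersLaw.Cruxes.NonBallistic.Disproof

open Literature.MathematicalPhysics.KineticTheory.HeatConduction
open Literature.MathematicalPhysics.KineticTheory.HeatConduction.OscillatorChain
open Literature.Barriers.AtomisticToContinuum
open Summit.AtomisticToContinuum.FouriersLaw.Theses.JunctionLocality

/-! ### §1 The conclusion as a property of a real sequence -/

/-- The conclusion of `NonBallistic` for a response sequence `D`: beyond every `N₀` there is a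
length with `D N ≤ ε (N - 1)`, i.e. the conductance `G_N = D_N/(N-1)` is not bounded away from
zero. -/
def NotBallisticSeq (D : ℕ → ℝ) : Prop :=
  ∀ ε : ℝ, 0 < ε → ∀ N₀ : ℕ, ∃ N : ℕ, N₀ ≤ N ∧ D N ≤ ε * ((N : ℝ) - 1)

/-- Negation = a BALLISTIC FLOOR: some `ε > 0` with `D N > ε (N - 1)` for all large `N`. -/
theorem not_notBallisticSeq_iff (D : ℕ → ℝ) :
    ¬ NotBallisticSeq D ↔ ∃ ε : ℝ, 0 < ε ∧ ∃ N₀ : ℕ, ∀ N : ℕ, N₀ ≤ N → ε * ((N : ℝ) - 1) < D N := by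
  unfold NotBallisticSeq
  push Not
  rfl

/-- A bounded response sequence is not ballistic. -/
theorem notBallisticSeq_of_bddAbove {D : ℕ → ℝ} (h : BddAbove (Set.range fun N => |D N|)) :
    NotBallisticSeq D := by
  obtain ⟨B, hB⟩ := h
  have hB' : ∀ N, D N ≤ B := fun N => (le_abs_self _).trans (hB ⟨N, rfl⟩)
  intro ε hε N₀
  obtain ⟨M, hM⟩ := exists_nat_ge (B / ε + 1)
  refine ⟨max N₀ M, le_max_left _ _, (hB' _).trans ?_⟩
  have hMN : (M : ℝ) ≤ ((max N₀ M : ℕ) : ℝ) := by exact_mod_cast le_max_right N₀ M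
  have h1 : B / ε ≤ ((max N₀ M : ℕ) : ℝ) - 1 := by linarith
  calc B = ε * (B / ε) := by field_simp
    _ ≤ ε * (((max N₀ M : ℕ) : ℝ) - 1) := mul_le_mul_of_nonneg_left h1 hε.le

/-- A convergent response sequence (Fourier behaviour, `D_N → κ`) is not ballistic. -/
theorem notBallisticSeq_of_tendsto {D : ℕ → ℝ} {κ : ℝ} (h : Tendsto D atTop (𝓝 κ)) :
    NotBallisticSeq D :=
  notBallisticSeq_of_bddAbove ((continuous_abs.tendsto _).comp h).bddAbove_range

/-- Vanishing conductance `G_N = D_N/(N-1) → 0` implies the conclusion (no superadditivity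
needed in this direction). -/
theorem notBallisticSeq_of_conductance_tendsto_zero {D : ℕ → ℝ}
    (h : Tendsto (fun N : ℕ => D N / ((N : ℝ) - 1)) atTop (𝓝 0)) : NotBallisticSeq D := by
  intro ε hε N₀
  have hev : ∀ᶠ N : ℕ in atTop, D N / ((N : ℝ) - 1) < ε := (tendsto_order.1 h).2 ε hε
  obtain ⟨M, hM⟩ := hev.exists_forall_of_atTop
  refine ⟨max (max N₀ 2) M, le_trans (le_max_left _ _) (le_max_left _ _), ?_⟩
  set N := max (max N₀ 2) M with hN
  have h2 : 2 ≤ N := le_trans (le_max_right _ _) (le_max_left _ _)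
  have hpos : (0 : ℝ) < (N : ℝ) - 1 := by
    have : (2 : ℝ) ≤ N := by exact_mod_cast h2
    linarith
  have := hM N (le_max_right _ _)
  rw [div_lt_iff₀ hpos] at this
  exact this.le

/-! ### §2 Degenerate lengths: `N ≤ 1` carries no current -/

/-- For `N ≤ 1` there is no bond, `totalCurrent = 0`, so every response limit is `0`:
`D 0 = D 1 = 0` are forced and the conclusion of the crux is free for `N₀ ≤ 1` (witness `N = 1`). -/
theorem totalCurrent_eq_zero_of_le_one (P : OscillatorChain) {N : ℕ} (hN : N ≤ 1)
    (μ : Measure (PhaseSpace N)) : P.totalCurrent μ = 0 := by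
  unfold totalCurrent
  refine Finset.sum_eq_zero fun i _ => ?_
  have hi : N ≤ i.val + 1 := by have := i.isLt; omega
  simp [P.bondCurrent_eq_zero_of_le i hi]

theorem response_eq_zero_of_le_one (P : OscillatorChain) {N : ℕ} (hN : N ≤ 1)
    (μ : ℝ → ℝ → Measure (PhaseSpace N)) {T d : ℝ}
    (hD : Tendsto (fun δ : ℝ => P.totalCurrent (μ (T + δ / 2) (T - δ / 2)) / δ) (𝓝[≠] 0) (𝓝 d)) :
    d = 0 := by
  have h0 : (fun δ : ℝ => P.totalCurrent (μ (T + δ / 2) (T - δ / 2)) / δ) = fun _ => 0 := by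
    funext δ; rw [totalCurrent_eq_zero_of_le_one P hN, zero_div]
  rw [h0] at hD
  exact tendsto_nhds_unique hD tendsto_const_nhds

/-- The free witness: whatever `D` is along a steady-state family, `D 1 ≤ ε · (1 - 1)`. -/
theorem conclusion_at_one (P : OscillatorChain) (μ : (N : ℕ) → ℝ → ℝ → Measure (PhaseSpace N))
    {T : ℝ} {D : ℕ → ℝ}
    (hD : ∀ N : ℕ, Tendsto (fun δ : ℝ => P.totalCurrent (μ N (T + δ / 2) (T - δ / 2)) / δ)
      (𝓝[≠] 0) (𝓝 (D N))) (ε : ℝ) :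
    D 1 ≤ ε * (((1 : ℕ) : ℝ) - 1) := by
  rw [response_eq_zero_of_le_one P le_rfl (μ 1) (hD 1)]
  simp

/-! ### §3 Necessity: a kill of the crux kills the conjunct -/

/-- `NonBallistic` follows from the catalogued barrier predicate `HasBoundedResponse` at every
admissible parameter point (the weak-uniqueness hypothesis of the crux is not even used). -/
theorem nonBallistic_of_forall_hasBoundedResponse
    (h : ∀ ω₂ lam β γ : ℝ, 0 < ω₂ → 0 < lam → 0 < β → 0 < γ →
      HasBoundedResponse (pinnedChain ω₂ lam β γ)) :
    NonBallistic := by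
  intro ω₂ lam β γ hω hl hβ hγ _huniq μ hμ T hT D hD
  exact notBallisticSeq_of_bddAbove (h ω₂ lam β γ hω hl hβ hγ μ hμ T hT D hD)

/-- Contrapositive bookkeeping: a refutation of the crux produces an admissible parameter point
where the finite-size conductivity is unbounded in `N`. -/
theorem exists_not_hasBoundedResponse_of_not_nonBallistic (h : ¬ NonBallistic) :
    ∃ ω₂ lam β γ : ℝ, 0 < ω₂ ∧ 0 < lam ∧ 0 < β ∧ 0 < γ ∧
      ¬ HasBoundedResponse (pinnedChain ω₂ lam β γ) := by
  by_contra hcon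
  push Not at hcon
  exact h (nonBallistic_of_forall_hasBoundedResponse fun ω₂ lam β γ hω hl hβ hγ =>
    hcon ω₂ lam β γ hω hl hβ hγ)

/-- **Necessity.** `¬ NonBallistic → ¬ FouriersLaw`: the crux is a consequence of the conjunct
(`hasBoundedResponse_of_fouriersLawFor`), so refuting it refutes Fourier's law for the pinned
quartic chain outright. -/
theorem not_fouriersLaw_of_not_nonBallistic (h : ¬ NonBallistic) : ¬ _root_.FouriersLaw := by
  intro hF
  obtain ⟨ω₂, lam, β, γ, hω, hl, hβ, hγ, hnot⟩ := exists_not_hasBoundedResponse_of_not_nonBallistic h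
  exact hnot (hasBoundedResponse_of_fouriersLawFor (hF ω₂ lam β γ hω hl hβ hγ))

/-- **Shape of a kill.** `¬ NonBallistic` unfolds to: an admissible parameter point WITH weak-NESS
uniqueness, a steady-state family, a temperature and a response sequence exhibiting a ballistic
floor `D N > ε (N - 1)` for all large `N`. -/
theorem not_nonBallistic_iff :
    ¬ NonBallistic ↔ ∃ ω₂ lam β γ : ℝ, 0 < ω₂ ∧ 0 < lam ∧ 0 < β ∧ 0 < γ ∧
      (∀ (N : ℕ) (T_L T_R : ℝ), 0 < T_L → 0 < T_R → ∀ μ ν : Measure (PhaseSpace N),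
        (pinnedChain ω₂ lam β γ).IsSteadyState N T_L T_R μ →
        (pinnedChain ω₂ lam β γ).IsSteadyState N T_L T_R ν → μ = ν) ∧
      ∃ μ : (N : ℕ) → ℝ → ℝ → Measure (PhaseSpace N),
        (∀ (N : ℕ) (T_L T_R : ℝ), 0 < T_L → 0 < T_R →
          (pinnedChain ω₂ lam β γ).IsSteadyState N T_L T_R (μ N T_L T_R)) ∧
        ∃ T : ℝ, 0 < T ∧ ∃ D : ℕ → ℝ,
          (∀ N : ℕ, Tendsto (fun δ : ℝ =>
            (pinnedChain ω₂ lam β γ).totalCurrent (μ N (T + δ / 2) (T - δ / 2)) / δ)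
            (𝓝[≠] 0) (𝓝 (D N))) ∧
          ∃ ε : ℝ, 0 < ε ∧ ∃ N₀ : ℕ, ∀ N : ℕ, N₀ ≤ N → ε * ((N : ℝ) - 1) < D N := by
  unfold NonBallistic
  push Not
  rfl

/-! ### §4 Load-bearing hypothesis: anharmonicity -/

/-- `NonBallistic` with the strict inequalities `0 < lam`, `0 < β` relaxed to `0 ≤ lam`, `0 ≤ β`
AND the weak-uniqueness hypothesis dropped (conclusion asked along every steady-state family). -/
def NonBallisticWithoutAnharmonicity : Prop :=
  ∀ ω₂ lam β γ : ℝ, 0 < ω₂ → 0 ≤ lam → 0 ≤ β → 0 < γ →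
    ∀ μ : (N : ℕ) → ℝ → ℝ → Measure (PhaseSpace N),
      (∀ (N : ℕ) (T_L T_R : ℝ), 0 < T_L → 0 < T_R →
        (pinnedChain ω₂ lam β γ).IsSteadyState N T_L T_R (μ N T_L T_R)) →
      ∀ T : ℝ, 0 < T → ∀ D : ℕ → ℝ,
        (∀ N : ℕ, Tendsto (fun δ : ℝ =>
          (pinnedChain ω₂ lam β γ).totalCurrent (μ N (T + δ / 2) (T - δ / 2)) / δ)
          (𝓝[≠] 0) (𝓝 (D N))) →
        NotBallisticSeq D

/-- The harmonic member is ballistic along the calibration family: at every `T > 0` its response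
sequence has a floor `D N > (N-1)/(2B)` (`HarmonicCalibration`: `(N-1)/D N ≤ B`, `D N > 0`). -/
theorem harmonic_ballistic {ω₂ γ : ℝ} (hω : 0 < ω₂) (hγ : 0 < γ) :
    ∃ μ : (N : ℕ) → ℝ → ℝ → Measure (PhaseSpace N),
      (∀ (N : ℕ) (T_L T_R : ℝ), 0 < T_L → 0 < T_R →
        (pinnedChain ω₂ 0 0 γ).IsSteadyState N T_L T_R (μ N T_L T_R)) ∧
      ∀ T : ℝ, 0 < T → ∃ D : ℕ → ℝ,
        (∀ N : ℕ, Tendsto (fun δ : ℝ =>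
          (pinnedChain ω₂ 0 0 γ).totalCurrent (μ N (T + δ / 2) (T - δ / 2)) / δ)
          (𝓝[≠] 0) (𝓝 (D N))) ∧
        ¬ NotBallisticSeq D := by
  obtain ⟨μ, hμ, hT⟩ :=
    Summit.AtomisticToContinuum.FouriersLaw.Theorems.JunctionLocality.harmonicCalibration_proof ω₂ γ hω hγ
  refine ⟨μ, hμ, fun T hT' => ?_⟩
  obtain ⟨D, hD, hpos, -, B, hB⟩ := hT T hT'
  refine ⟨D, hD, ?_⟩
  rw [not_notBallisticSeq_iff]
  have h2 := hB 2 le_rfl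
  have hD2 := hpos 2 le_rfl
  have hB0 : 0 < B := by
    have : (0 : ℝ) < (((2 : ℕ) : ℝ) - 1) / D 2 := div_pos (by norm_num) hD2
    linarith
  refine ⟨1 / (2 * B), by positivity, 2, fun N hN => ?_⟩
  have hN' : (0 : ℝ) < (N : ℝ) - 1 := by
    have : (2 : ℝ) ≤ N := by exact_mod_cast hN
    linarith
  have hDN := hpos N hN
  have hRN := hB N hN
  -- (N-1)/D N ≤ B  ⇒  (N-1) ≤ B · D N  ⇒  (N-1)/(2B) < D N
  rw [div_le_iff₀ hDN] at hRN
  have : 1 / (2 * B) * ((N : ℝ) - 1) = ((N : ℝ) - 1) / (2 * B) := by ring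
  rw [this, div_lt_iff₀ (by positivity)]
  nlinarith

/-- **Any proof must use anharmonicity**: the relaxed statement is false, witnessed by the pinned
harmonic chain `pinnedChain 1 0 0 1` at `T = 1`. -/
theorem nonBallistic_false_without_anharmonicity : ¬ NonBallisticWithoutAnharmonicity := by
  intro h
  obtain ⟨μ, hμ, hT⟩ := harmonic_ballistic one_pos one_pos
  obtain ⟨D, hD, hnot⟩ := hT 1 one_pos
  exact hnot (h 1 0 0 1 one_pos le_rfl le_rfl one_pos μ hμ 1 one_pos D hD)

/-- `NonBallistic` VERBATIM except that `0 < lam → 0 < β →` is replaced by `0 ≤ lam → 0 ≤ β →`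
(the weak-uniqueness hypothesis is kept). -/
def NonBallisticClosedRange : Prop :=
  ∀ ω₂ lam β γ : ℝ, 0 < ω₂ → 0 ≤ lam → 0 ≤ β → 0 < γ →
    (∀ (N : ℕ) (T_L T_R : ℝ), 0 < T_L → 0 < T_R → ∀ μ ν : Measure (PhaseSpace N),
      (pinnedChain ω₂ lam β γ).IsSteadyState N T_L T_R μ →
      (pinnedChain ω₂ lam β γ).IsSteadyState N T_L T_R ν → μ = ν) →
    ∀ μ : (N : ℕ) → ℝ → ℝ → Measure (PhaseSpace N),
      (∀ (N : ℕ) (T_L T_R : ℝ), 0 < T_L → 0 < T_R →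
        (pinnedChain ω₂ lam β γ).IsSteadyState N T_L T_R (μ N T_L T_R)) →
      ∀ T : ℝ, 0 < T → ∀ D : ℕ → ℝ,
        (∀ N : ℕ, Tendsto (fun δ : ℝ =>
          (pinnedChain ω₂ lam β γ).totalCurrent (μ N (T + δ / 2) (T - δ / 2)) / δ)
          (𝓝[≠] 0) (𝓝 (D N))) →
        ∀ ε : ℝ, 0 < ε → ∀ N₀ : ℕ, ∃ N : ℕ, N₀ ≤ N ∧ D N ≤ ε * ((N : ℝ) - 1)

/-- Weak-NESS uniqueness for the pinned HARMONIC chain `pinnedChain ω₂ 0 0 γ` (true in print —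
the Gaussian invariant measure of a controllable Ornstein–Uhlenbeck process is its unique
stationary Fokker–Planck probability solution — but not in the tree; the `lam = β = 0` instance of
the open item `NessUnique`'s uniqueness mechanism). [cite: BonettoLebowitzReyBellet2000, §6.2] -/
def HarmonicNessUnique (ω₂ γ : ℝ) : Prop :=
  ∀ (N : ℕ) (T_L T_R : ℝ), 0 < T_L → 0 < T_R → ∀ μ ν : Measure (PhaseSpace N),
    (pinnedChain ω₂ 0 0 γ).IsSteadyState N T_L T_R μ →
    (pinnedChain ω₂ 0 0 γ).IsSteadyState N T_L T_R ν → μ = ν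

/-- **The crux's exact shape dies at the harmonic corner, modulo harmonic weak uniqueness.**
`HarmonicNessUnique ω₂ γ → ¬ NonBallisticClosedRange` for any `ω₂, γ > 0`. -/
theorem nonBallisticClosedRange_false_of_harmonicNessUnique {ω₂ γ : ℝ} (hω : 0 < ω₂) (hγ : 0 < γ)
    (hU : HarmonicNessUnique ω₂ γ) : ¬ NonBallisticClosedRange := by
  intro h
  obtain ⟨μ, hμ, hT⟩ := harmonic_ballistic hω hγ
  obtain ⟨D, hD, hnot⟩ := hT 1 one_pos
  exact hnot (h ω₂ 0 0 γ hω le_rfl le_rfl hγ hU μ hμ 1 one_pos D hD)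


/-! ### §5 The exact shape of a kill on the route's own terms: the certificate dichotomy

Under clause (A) `SuperadditiveResistance` (constant `C`) and positivity `D_N > 0` (`N ≥ 2`),
write `R_N := (N-1)/D_N`. Then EITHER `R_N ≤ C` for every `N ≥ 2` (uniformly bounded resistance:
the ballistic branch, where the harmonic member sits) OR the conductance `G_N = 1/R_N` tends to
`0`. Consequently the conclusion of the crux is equivalent to ONE finite certificate `R_{N₀} > C`
and to `G_N → 0`; a disproof (given (A)) must therefore prove `sup_N R_N ≤ C`. -/

section Certificate

variable {D : ℕ → ℝ} {C : ℝ}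

/-- Iterated superadditivity: from a certificate `a := R_{N₀} - C > 0`... more precisely, for all
`k` and `r ≥ 2`, `k · (R_{N₀} - C) + R_r ≤ R_{k N₀ + r}`. -/
theorem resistance_growth
    (hsup : ∀ N M : ℕ, 2 ≤ N → 2 ≤ M →
      ((N : ℝ) - 1) / D N + ((M : ℝ) - 1) / D M - C ≤ ((N : ℝ) + (M : ℝ) - 1) / D (N + M))
    {N₀ : ℕ} (hN₀ : 2 ≤ N₀) :
    ∀ k r : ℕ, 2 ≤ r →
      (k : ℝ) * (((N₀ : ℝ) - 1) / D N₀ - C) + ((r : ℝ) - 1) / D r ≤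
        (((k * N₀ + r : ℕ) : ℝ) - 1) / D (k * N₀ + r) := by
  intro k
  induction k with
  | zero =>
    intro r hr
    simp
  | succ k ih =>
    intro r hr
    have hkr : 2 ≤ k * N₀ + r := le_add_left hr
    have step := hsup N₀ (k * N₀ + r) hN₀ hkr
    have e : N₀ + (k * N₀ + r) = (k + 1) * N₀ + r := by ring
    rw [e] at step
    have ih' := ih r hr
    push_cast at step ih' ⊢
    have e2 : ((N₀ : ℝ) + ((k : ℝ) * (N₀ : ℝ) + (r : ℝ)) - 1) = ((k : ℝ) + 1) * (N₀ : ℝ) + (r : ℝ) - 1 := by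
      ring
    rw [e2] at step
    linarith [step, ih']

/-- **Dichotomy.** Bounded resistance or vanishing conductance. -/
theorem conductance_dichotomy
    (hpos : ∀ N : ℕ, 2 ≤ N → 0 < D N)
    (hsup : ∀ N M : ℕ, 2 ≤ N → 2 ≤ M →
      ((N : ℝ) - 1) / D N + ((M : ℝ) - 1) / D M - C ≤ ((N : ℝ) + (M : ℝ) - 1) / D (N + M)) :
    (∀ N : ℕ, 2 ≤ N → ((N : ℝ) - 1) / D N ≤ C) ∨
      Tendsto (fun N : ℕ => D N / ((N : ℝ) - 1)) atTop (𝓝 0) := by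
  by_cases hcert : ∃ N₀ : ℕ, 2 ≤ N₀ ∧ C < ((N₀ : ℝ) - 1) / D N₀
  swap
  · left
    push Not at hcert
    exact hcert
  right
  obtain ⟨N₀, hN₀, hC⟩ := hcert
  set a : ℝ := ((N₀ : ℝ) - 1) / D N₀ - C with ha
  have ha0 : 0 < a := by rw [ha]; linarith
  have hR : ∀ N : ℕ, 2 ≤ N → 0 < ((N : ℝ) - 1) / D N := fun N hN => by
    have : (2 : ℝ) ≤ N := by exact_mod_cast hN
    exact div_pos (by linarith) (hpos N hN)
  -- lower bound on the resistance of every long chain: write N = k N₀ + r, 2 ≤ r ≤ N₀ + 1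
  have hlow : ∀ N : ℕ, 2 ≤ N → (((N - 2) / N₀ : ℕ) : ℝ) * a ≤ ((N : ℝ) - 1) / D N := by
    intro N hN
    set k : ℕ := (N - 2) / N₀ with hk
    set r : ℕ := (N - 2) % N₀ + 2 with hr
    have hNkr : N = k * N₀ + r := by
      have := Nat.div_add_mod (N - 2) N₀
      rw [hk, hr]
      have : N₀ * ((N - 2) / N₀) + (N - 2) % N₀ = N - 2 := this
      nlinarith [this, Nat.mul_comm N₀ ((N - 2) / N₀), Nat.sub_add_cancel hN]
    have hr2 : 2 ≤ r := by rw [hr]; omega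
    have key := resistance_growth hsup hN₀ k r hr2
    rw [← hNkr] at key
    have := hR r hr2
    rw [ha]
    linarith
  -- conclude G_N = 1/R_N → 0
  rw [tendsto_order]
  refine ⟨fun η hη => ?_, fun η hη => ?_⟩
  · filter_upwards [eventually_ge_atTop 2] with N hN
    exact hη.trans (div_pos (hpos N hN) (by
      have : (2 : ℝ) ≤ N := by exact_mod_cast hN
      linarith))
  · obtain ⟨m, hm⟩ := exists_nat_gt (1 / (η * a))
    filter_upwards [eventually_ge_atTop (m * N₀ + 2)] with N hN
    have hN2 : 2 ≤ N := le_of_add_le_right hN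
    have hkm : m ≤ (N - 2) / N₀ := by
      rw [Nat.le_div_iff_mul_le (by omega)]
      omega
    have hkm' : (m : ℝ) ≤ (((N - 2) / N₀ : ℕ) : ℝ) := by exact_mod_cast hkm
    have h1 : 1 / η < (m : ℝ) * a := by
      rw [div_lt_iff₀ hη]
      have := (div_lt_iff₀ (mul_pos hη ha0)).1 hm
      linarith
    have h2 : 1 / η < ((N : ℝ) - 1) / D N :=
      lt_of_lt_of_le (h1.trans_le (mul_le_mul_of_nonneg_right hkm' ha0.le)) (hlow N hN2)
    have hDN := hpos N hN2
    have hN1 : (0 : ℝ) < (N : ℝ) - 1 := by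
      have : (2 : ℝ) ≤ N := by exact_mod_cast hN2
      linarith
    -- 1/η < (N-1)/D N  ⇒  D N/(N-1) < η
    rw [div_lt_iff₀ hN1]
    rw [div_lt_div_iff₀ hη hDN, one_mul] at h2
    linarith

/-- **Certificate form.** Given (A) and positivity, the conclusion of the crux holds iff ONE
length `N₀ ≥ 2` has resistance above the insertion constant, `R_{N₀} > C`. -/
theorem notBallisticSeq_iff_exists_certificate
    (hpos : ∀ N : ℕ, 2 ≤ N → 0 < D N)
    (hsup : ∀ N M : ℕ, 2 ≤ N → 2 ≤ M →
      ((N : ℝ) - 1) / D N + ((M : ℝ) - 1) / D M - C ≤ ((N : ℝ) + (M : ℝ) - 1) / D (N + M)) :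
    NotBallisticSeq D ↔ ∃ N₀ : ℕ, 2 ≤ N₀ ∧ C < ((N₀ : ℝ) - 1) / D N₀ := by
  constructor
  · intro h
    by_contra hno
    push Not at hno
    -- all resistances ≤ C, so C > 0 and D N ≥ (N-1)/C: a ballistic floor with ε = 1/(2C)
    have hC : 0 < C := by
      have h2 := hno 2 le_rfl
      have : (0 : ℝ) < (((2 : ℕ) : ℝ) - 1) / D 2 := div_pos (by norm_num) (hpos 2 le_rfl)
      linarith
    obtain ⟨N, hN, hDN⟩ := h (1 / (2 * C)) (by positivity) 2
    have hN1 : (0 : ℝ) < (N : ℝ) - 1 := by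
      have : (2 : ℝ) ≤ N := by exact_mod_cast hN
      linarith
    have hRN := hno N hN
    rw [div_le_iff₀ (hpos N hN)] at hRN
    have : 1 / (2 * C) * ((N : ℝ) - 1) < D N := by
      rw [show 1 / (2 * C) * ((N : ℝ) - 1) = ((N : ℝ) - 1) / (2 * C) by ring,
        div_lt_iff₀ (by positivity)]
      nlinarith [hpos N hN]
    linarith
  · rintro ⟨N₀, hN₀, hC⟩
    rcases conductance_dichotomy hpos hsup with hbdd | hlim
    · exact absurd (hbdd N₀ hN₀) (not_le.2 hC)
    · exact notBallisticSeq_of_conductance_tendsto_zero hlim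

/-- **Limit form.** Given (A) and positivity, `liminf_N G_N = 0` upgrades to `G_N → 0`. -/
theorem notBallisticSeq_iff_conductance_tendsto_zero
    (hpos : ∀ N : ℕ, 2 ≤ N → 0 < D N)
    (hsup : ∀ N M : ℕ, 2 ≤ N → 2 ≤ M →
      ((N : ℝ) - 1) / D N + ((M : ℝ) - 1) / D M - C ≤ ((N : ℝ) + (M : ℝ) - 1) / D (N + M)) :
    NotBallisticSeq D ↔ Tendsto (fun N : ℕ => D N / ((N : ℝ) - 1)) atTop (𝓝 0) := by
  refine ⟨fun h => ?_, notBallisticSeq_of_conductance_tendsto_zero⟩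
  rcases conductance_dichotomy hpos hsup with hbdd | hlim
  · exfalso
    obtain ⟨N₀, hN₀, hC⟩ := (notBallisticSeq_iff_exists_certificate hpos hsup).1 h
    exact absurd (hbdd N₀ hN₀) (not_le.2 hC)
  · exact hlim

/-- **What a disproof must show, given (A).** If the crux's conclusion fails for a positive
response sequence obeying superadditivity with constant `C`, then the resistance is uniformly
bounded: `R_N ≤ C` for all `N ≥ 2` (bounded resistance = linear growth `D_N ≥ (N-1)/C`). -/
theorem resistance_bounded_of_not_notBallisticSeq
    (hpos : ∀ N : ℕ, 2 ≤ N → 0 < D N)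
    (hsup : ∀ N M : ℕ, 2 ≤ N → 2 ≤ M →
      ((N : ℝ) - 1) / D N + ((M : ℝ) - 1) / D M - C ≤ ((N : ℝ) + (M : ℝ) - 1) / D (N + M))
    (h : ¬ NotBallisticSeq D) : ∀ N : ℕ, 2 ≤ N → ((N : ℝ) - 1) / D N ≤ C := by
  intro N hN
  by_contra hC
  exact h ((notBallisticSeq_iff_exists_certificate hpos hsup).2 ⟨N, hN, not_le.1 hC⟩)

end Certificate

/-! ### §6 Why a Mazur-type kill is empty: parity under momentum reversal

Ballistic transport (`¬ NonBallistic`) in Hamiltonian chains comes from a conserved quantity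
overlapping the current (Mazur 1969; the harmonic member: energies of the normal modes). For the
quartic pinned chain the only local conserved quantity known is `H` itself, and the static overlap
of the (total) current with any function of `H` vanishes identically by momentum reversal — in
every reversal-symmetric state, in particular every Gibbs state and every even density. -/

section Parity

variable (P : OscillatorChain) {N : ℕ}

/-- Momentum reversal `(q, p) ↦ (q, -p)` on phase space. -/
def momentumReversal (N : ℕ) (x : PhaseSpace N) : PhaseSpace N := (x.1, -x.2)

@[simp] theorem momentumReversal_fst (x : PhaseSpace N) : (momentumReversal N x).1 = x.1 := rfl
@[simp] theorem momentumReversal_snd (x : PhaseSpace N) : (momentumReversal N x).2 = -x.2 := rfl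

theorem momentumReversal_involutive : Function.Involutive (momentumReversal N) := by
  intro x; simp [momentumReversal]

theorem measurable_momentumReversal : Measurable (momentumReversal N) :=
  measurable_fst.prodMk measurable_snd.neg

/-- Momentum reversal as a measurable involution of phase space. -/
def momentumReversalEquiv (N : ℕ) : PhaseSpace N ≃ᵐ PhaseSpace N where
  toFun := momentumReversal N
  invFun := momentumReversal N
  left_inv := momentumReversal_involutive
  right_inv := momentumReversal_involutive
  measurable_toFun := measurable_momentumReversal
  measurable_invFun := measurable_momentumReversal

@[simp] theorem coe_momentumReversalEquiv :
    ((momentumReversalEquiv N : PhaseSpace N ≃ᵐ PhaseSpace N) : PhaseSpace N → PhaseSpace N) =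
      momentumReversal N := rfl

/-- The bond currents are ODD under momentum reversal. -/
theorem bondCurrent_momentumReversal (i : Fin N) (x : PhaseSpace N) :
    P.bondCurrent N i (momentumReversal N x) = - P.bondCurrent N i x := by
  unfold bondCurrent
  rw [← Finset.sum_neg_distrib]
  refine Finset.sum_congr rfl fun j _ => ?_
  split_ifs with h
  · simp only [momentumReversal_fst, momentumReversal_snd, Pi.neg_apply]
    ring
  · simp

/-- The Hamiltonian is EVEN under momentum reversal. -/
theorem hamiltonian_momentumReversal (x : PhaseSpace N) :
    P.hamiltonian N (momentumReversal N x) = P.hamiltonian N x := by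
  unfold hamiltonian
  simp [momentumReversal]

/-- **Zero Mazur numerator.** In any momentum-reversal-symmetric state `μ`, the static overlap of
the total current with every function of the energy vanishes:
`∫ (∑_i j_i) · F(H) dμ = 0` (no integrability needed: both sides are Bochner integrals). -/
theorem integral_totalCurrent_mul_hamiltonian_eq_zero (μ : Measure (PhaseSpace N))
    (hμ : μ.map (momentumReversal N) = μ) (F : ℝ → ℝ) :
    ∫ x, (∑ i, P.bondCurrent N i x) * F (P.hamiltonian N x) ∂μ = 0 := by
  set f : PhaseSpace N → ℝ := fun x => (∑ i, P.bondCurrent N i x) * F (P.hamiltonian N x) with hf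
  have hodd : ∀ x, f (momentumReversal N x) = - f x := by
    intro x
    simp only [hf, bondCurrent_momentumReversal, hamiltonian_momentumReversal, Finset.sum_neg_distrib]
    ring
  have h1 : ∫ x, f x ∂μ = ∫ x, f (momentumReversal N x) ∂μ := by
    have key := integral_map_equiv (μ := μ) (momentumReversalEquiv N) f
    rw [coe_momentumReversalEquiv, hμ] at key
    exact key
  have h2 : ∫ x, f (momentumReversal N x) ∂μ = - ∫ x, f x ∂μ := by
    simp_rw [hodd]
    exact integral_neg f
  show ∫ x, f x ∂μ = 0
  linarith [h1.trans h2]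

end Parity


/-! ### §7 Scaling conjugacy: the crux is its `T = 1` slice over all `(lam, β) > 0`

The amplitude scaling `(q,p) ↦ (s q, s p)` conjugates `pinnedChain ω₂ (lam s²) (β s²) γ` at bath
temperatures `(a, b)` to `pinnedChain ω₂ lam β γ` at `(s² a, s² b)` and multiplies currents by `s²`
(`LowTemperatureWeakAnharmonicity.lean`). Hence the difference quotients, the response sequences
`D` and the weak-uniqueness hypothesis are INVARIANT: the crux at `(lam, β, T)` is the crux at
`(lam T, β T, 1)`. Consequences: (i) `NonBallistic ↔ ∀ ω₂ lam β γ > 0, NonBallisticAtTemp ω₂ lam β γ 1`;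
(ii) the witness length `N₀(ε; lam, β, T) = N₀(ε; lam T, β T, 1)` — low temperature IS weak
anharmonicity, the `T ↓ 0` limit point being the harmonic member where the conclusion FAILS
(§4), so no `N₀` uniform in `T` (or in `(lam, β) → 0`) can exist if `D_N` depends continuously on
the couplings at fixed `N` (remark; not formalised); (iii) a finite certificate (§5) at one
parameter point settles exactly one hyperbola `{lam·T = c₁, β·T = c₂}`. -/

section Scaling

open Literature.Barriers.AtomisticToContinuum.HeatConduction

/-- The crux at ONE parameter point and ONE temperature. -/
def NonBallisticAtTemp (ω₂ lam β γ T : ℝ) : Prop :=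
  (∀ (N : ℕ) (T_L T_R : ℝ), 0 < T_L → 0 < T_R → ∀ μ ν : Measure (PhaseSpace N),
    (pinnedChain ω₂ lam β γ).IsSteadyState N T_L T_R μ →
    (pinnedChain ω₂ lam β γ).IsSteadyState N T_L T_R ν → μ = ν) →
  ∀ μ : (N : ℕ) → ℝ → ℝ → Measure (PhaseSpace N),
    (∀ (N : ℕ) (T_L T_R : ℝ), 0 < T_L → 0 < T_R →
      (pinnedChain ω₂ lam β γ).IsSteadyState N T_L T_R (μ N T_L T_R)) →
    ∀ D : ℕ → ℝ,
      (∀ N : ℕ, Tendsto (fun δ : ℝ =>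
        (pinnedChain ω₂ lam β γ).totalCurrent (μ N (T + δ / 2) (T - δ / 2)) / δ)
        (𝓝[≠] 0) (𝓝 (D N))) →
      NotBallisticSeq D

/-- `NonBallistic` is the conjunction of its slices (pure quantifier shuffling). -/
theorem nonBallistic_iff_forall_atTemp :
    NonBallistic ↔ ∀ ω₂ lam β γ : ℝ, 0 < ω₂ → 0 < lam → 0 < β → 0 < γ →
      ∀ T : ℝ, 0 < T → NonBallisticAtTemp ω₂ lam β γ T := by
  constructor
  · intro h ω₂ lam β γ hω hl hβ hγ T hT huniq μ hμ D hD
    exact h ω₂ lam β γ hω hl hβ hγ huniq μ hμ T hT D hD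
  · intro h ω₂ lam β γ hω hl hβ hγ huniq μ hμ T hT D hD
    exact h ω₂ lam β γ hω hl hβ hγ T hT huniq μ hμ D hD

/-- `map (s⁻¹ • ·) ∘ map (s • ·) = id` on measures of the phase space (`s ≠ 0`). -/
theorem map_inv_smul_map_smul {N : ℕ} {s : ℝ} (hs : s ≠ 0) (ν : Measure (PhaseSpace N)) :
    (ν.map fun x => s • x).map (fun x => s⁻¹ • x) = ν := by
  have := map_smul_map_inv_smul (N := N) (inv_ne_zero hs) ν
  rwa [inv_inv] at this

/-- Weak-NESS uniqueness is invariant under the amplitude scaling. -/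
theorem nessUnique_smul {ω₂ lam β γ s : ℝ} (hs : s ≠ 0)
    (huniq : ∀ (N : ℕ) (T_L T_R : ℝ), 0 < T_L → 0 < T_R → ∀ μ ν : Measure (PhaseSpace N),
      (pinnedChain ω₂ lam β γ).IsSteadyState N T_L T_R μ →
      (pinnedChain ω₂ lam β γ).IsSteadyState N T_L T_R ν → μ = ν) :
    ∀ (N : ℕ) (T_L T_R : ℝ), 0 < T_L → 0 < T_R → ∀ μ ν : Measure (PhaseSpace N),
      (pinnedChain ω₂ (lam * s ^ 2) (β * s ^ 2) γ).IsSteadyState N T_L T_R μ →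
      (pinnedChain ω₂ (lam * s ^ 2) (β * s ^ 2) γ).IsSteadyState N T_L T_R ν → μ = ν := by
  have hs2 : (0 : ℝ) < s ^ 2 := by positivity
  intro N a b ha hb μ ν hμ hν
  have hμ' := isSteadyState_map_smul ω₂ lam β γ hs hμ
  have hν' := isSteadyState_map_smul ω₂ lam β γ hs hν
  have heq := huniq N _ _ (mul_pos hs2 ha) (mul_pos hs2 hb) _ _ hμ' hν'
  rw [← map_inv_smul_map_smul hs μ, ← map_inv_smul_map_smul hs ν, heq]

/-- **Scaling transfer.** The slice at `(lam s², β s², T)` gives the slice at `(lam, β, s² T)`. -/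
theorem nonBallisticAtTemp_of_smul (ω₂ lam β γ : ℝ) {s : ℝ} (hs : s ≠ 0) {T : ℝ}
    (h : NonBallisticAtTemp ω₂ (lam * s ^ 2) (β * s ^ 2) γ T) :
    NonBallisticAtTemp ω₂ lam β γ (s ^ 2 * T) := by
  have hs2 : (0 : ℝ) < s ^ 2 := by positivity
  set P := pinnedChain ω₂ lam β γ with hP
  set P' := pinnedChain ω₂ (lam * s ^ 2) (β * s ^ 2) γ with hP'
  intro huniq μ hμ D hD
  -- the conjugate family of the scaled chain
  set ν : (N : ℕ) → ℝ → ℝ → Measure (PhaseSpace N) := fun N a b =>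
    (μ N (s ^ 2 * a) (s ^ 2 * b)).map fun x => s⁻¹ • x with hν
  have hνst : ∀ (N : ℕ) (a b : ℝ), 0 < a → 0 < b → P'.IsSteadyState N a b (ν N a b) := by
    intro N a b ha hb
    have := isSteadyState_map_inv_smul ω₂ lam β γ hs
      (hμ N (s ^ 2 * a) (s ^ 2 * b) (mul_pos hs2 ha) (mul_pos hs2 hb))
    have e1 : s⁻¹ ^ 2 * (s ^ 2 * a) = a := by field_simp
    have e2 : s⁻¹ ^ 2 * (s ^ 2 * b) = b := by field_simp
    rw [e1, e2] at this
    exact this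
  refine h (nessUnique_smul hs huniq) ν hνst D fun N => ?_
  -- the difference quotients agree under δ' ↦ s² δ'
  have hμν : ∀ a b : ℝ, μ N (s ^ 2 * a) (s ^ 2 * b) = (ν N a b).map fun x => s • x := by
    intro a b
    exact (map_smul_map_inv_smul hs _).symm
  have hid : ∀ δ : ℝ, P'.totalCurrent (ν N (T + δ / 2) (T - δ / 2)) / δ =
      P.totalCurrent (μ N (s ^ 2 * T + s ^ 2 * δ / 2) (s ^ 2 * T - s ^ 2 * δ / 2)) /
        (s ^ 2 * δ) := by
    intro δ
    have ha : s ^ 2 * T + s ^ 2 * δ / 2 = s ^ 2 * (T + δ / 2) := by ring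
    have hb : s ^ 2 * T - s ^ 2 * δ / 2 = s ^ 2 * (T - δ / 2) := by ring
    rw [ha, hb, hμν, totalCurrent_map_smul ω₂ lam β γ hs, ← hP']
    field_simp
  have hcomp : Tendsto (fun δ : ℝ => s ^ 2 * δ) (𝓝[≠] 0) (𝓝[≠] 0) := by
    refine tendsto_nhdsWithin_of_tendsto_nhds_of_eventually_within _ ?_ ?_
    · have : Tendsto (fun δ : ℝ => s ^ 2 * δ) (𝓝 0) (𝓝 (s ^ 2 * 0)) :=
        tendsto_id.const_mul _
      rw [mul_zero] at this
      exact this.mono_left nhdsWithin_le_nhds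
    · filter_upwards [self_mem_nhdsWithin] with δ hδ
      exact mul_ne_zero hs2.ne' hδ
  refine ((hD N).comp hcomp).congr fun δ => ?_
  rw [Function.comp_apply, hid δ]

/-- Converse transfer (`s ↦ s⁻¹`): the slice at `(lam, β, T)` gives the slice at
`(lam s², β s², T / s²)`. -/
theorem nonBallisticAtTemp_smul_of (ω₂ lam β γ : ℝ) {s : ℝ} (hs : s ≠ 0) {T : ℝ}
    (h : NonBallisticAtTemp ω₂ lam β γ T) :
    NonBallisticAtTemp ω₂ (lam * s ^ 2) (β * s ^ 2) γ (T / s ^ 2) := by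
  have key := @nonBallisticAtTemp_of_smul ω₂ (lam * s ^ 2) (β * s ^ 2) γ s⁻¹ (inv_ne_zero hs) T
  have e1 : lam * s ^ 2 * s⁻¹ ^ 2 = lam := by field_simp
  have e2 : β * s ^ 2 * s⁻¹ ^ 2 = β := by field_simp
  have e3 : s⁻¹ ^ 2 * T = T / s ^ 2 := by field_simp
  rw [e1, e2, e3] at key
  exact key h

/-- **WLOG `T = 1`.** The slice at `(lam, β, T)` is equivalent to the slice at `(lam T, β T, 1)`. -/
theorem nonBallisticAtTemp_iff_unit_temperature (ω₂ lam β γ : ℝ) {T : ℝ} (hT : 0 < T) :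
    NonBallisticAtTemp ω₂ lam β γ T ↔ NonBallisticAtTemp ω₂ (lam * T) (β * T) γ 1 := by
  have hs : Real.sqrt T ≠ 0 := (Real.sqrt_pos.mpr hT).ne'
  have hsq : Real.sqrt T ^ 2 = T := Real.sq_sqrt hT.le
  constructor
  · intro h
    have key := nonBallisticAtTemp_smul_of ω₂ lam β γ hs h
    rwa [hsq, div_self hT.ne'] at key
  · intro h
    have key := nonBallisticAtTemp_of_smul ω₂ lam β γ hs (T := 1) (by rwa [hsq])
    rwa [hsq, mul_one] at key

/-- **The crux is its `T = 1` slice** over all admissible `(ω₂, lam, β, γ)`: the temperature is the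
anharmonic coupling in disguise. -/
theorem nonBallistic_iff_unit_temperature :
    NonBallistic ↔ ∀ ω₂ lam β γ : ℝ, 0 < ω₂ → 0 < lam → 0 < β → 0 < γ →
      NonBallisticAtTemp ω₂ lam β γ 1 := by
  rw [nonBallistic_iff_forall_atTemp]
  constructor
  · intro h ω₂ lam β γ hω hl hβ hγ
    exact h ω₂ lam β γ hω hl hβ hγ 1 one_pos
  · intro h ω₂ lam β γ hω hl hβ hγ T hT
    rw [nonBallisticAtTemp_iff_unit_temperature ω₂ lam β γ hT]
    exact h ω₂ (lam * T) (β * T) γ hω (mul_pos hl hT) (mul_pos hβ hT) hγ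

/-- Equivalently WLOG `lam = 1`: the crux is a statement about the two-parameter family
`(β/lam, lam T)` (here: its `lam = 1` slice at all temperatures). -/
theorem nonBallistic_iff_unit_pinning :
    NonBallistic ↔ ∀ ω₂ β γ : ℝ, 0 < ω₂ → 0 < β → 0 < γ →
      ∀ T : ℝ, 0 < T → NonBallisticAtTemp ω₂ 1 β γ T := by
  rw [nonBallistic_iff_forall_atTemp]
  constructor
  · intro h ω₂ β γ hω hβ hγ T hT
    exact h ω₂ 1 β γ hω one_pos hβ hγ T hT
  · intro h ω₂ lam β γ hω hl hβ hγ T hT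
    -- (lam, β, T) ~ (1, β/lam, lam T): scale with s² = 1/lam
    have hs : (Real.sqrt lam)⁻¹ ≠ 0 := inv_ne_zero (Real.sqrt_pos.mpr hl).ne'
    have hsq : (Real.sqrt lam)⁻¹ ^ 2 = lam⁻¹ := by rw [inv_pow, Real.sq_sqrt hl.le]
    have key := nonBallisticAtTemp_of_smul ω₂ lam β γ hs (T := lam * T) ?_
    · have e : (Real.sqrt lam)⁻¹ ^ 2 * (lam * T) = T := by rw [hsq]; field_simp
      rwa [e] at key
    · rw [hsq, mul_inv_cancel₀ hl.ne', ← div_eq_mul_inv]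
      exact h ω₂ (β / lam) γ hω (div_pos hβ hl) hγ (lam * T) (mul_pos hl hT)

end Scaling


/-! ### §8 Bookkeeping for provers: one statement in three routes; one family suffices -/

section Bookkeeping

/-- The three routes' `NonBallistic` decls are ONE statement. -/
theorem nonBallistic_iff_bondHeat :
    NonBallistic ↔ Summit.AtomisticToContinuum.FouriersLaw.Theses.BondHeatUncertainty.NonBallistic :=
  Iff.rfl

theorem nonBallistic_iff_puiseux :
    NonBallistic ↔ Summit.AtomisticToContinuum.FouriersLaw.Theses.PuiseuxTransferLedger.NonBallistic :=
  Iff.rfl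

/-- `BondHeatUncertainty.BoundedResponse` (= `HasBoundedResponse` at every admissible parameter
point, no uniqueness) implies the crux. -/
theorem nonBallistic_of_boundedResponse
    (h : Summit.AtomisticToContinuum.FouriersLaw.Theses.BondHeatUncertainty.BoundedResponse) :
    NonBallistic :=
  nonBallistic_of_forall_hasBoundedResponse fun ω₂ lam β γ hω hl hβ hγ =>
    h ω₂ lam β γ hω hl hβ hγ

/-- Under weak uniqueness, difference quotients — hence response limits — transfer between any
two admissible steady-state families (they agree once `T ± δ/2 > 0`). -/
theorem response_transfer_of_unique (P : OscillatorChain)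
    (huniq : ∀ (N : ℕ) (T_L T_R : ℝ), 0 < T_L → 0 < T_R → ∀ μ ν : Measure (PhaseSpace N),
      P.IsSteadyState N T_L T_R μ → P.IsSteadyState N T_L T_R ν → μ = ν)
    {μ₀ μ : (N : ℕ) → ℝ → ℝ → Measure (PhaseSpace N)}
    (hμ₀ : ∀ (N : ℕ) (T_L T_R : ℝ), 0 < T_L → 0 < T_R → P.IsSteadyState N T_L T_R (μ₀ N T_L T_R))
    (hμ : ∀ (N : ℕ) (T_L T_R : ℝ), 0 < T_L → 0 < T_R → P.IsSteadyState N T_L T_R (μ N T_L T_R))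
    {T : ℝ} (hT : 0 < T) {N : ℕ} {d : ℝ}
    (hD : Tendsto (fun δ : ℝ => P.totalCurrent (μ N (T + δ / 2) (T - δ / 2)) / δ) (𝓝[≠] 0) (𝓝 d)) :
    Tendsto (fun δ : ℝ => P.totalCurrent (μ₀ N (T + δ / 2) (T - δ / 2)) / δ) (𝓝[≠] 0) (𝓝 d) := by
  refine hD.congr' ?_
  have h2 : ∀ᶠ δ in 𝓝 (0 : ℝ), δ < 2 * T := eventually_lt_nhds (by linarith)
  have h2' : ∀ᶠ δ in 𝓝 (0 : ℝ), -(2 * T) < δ := eventually_gt_nhds (by linarith)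
  filter_upwards [mem_nhdsWithin_of_mem_nhds h2, mem_nhdsWithin_of_mem_nhds h2'] with δ hlt hgt
  have ha : 0 < T + δ / 2 := by linarith
  have hb : 0 < T - δ / 2 := by linarith
  rw [huniq N _ _ ha hb _ _ (hμ N _ _ ha hb) (hμ₀ N _ _ ha hb)]

/-- **One family suffices.** Under the crux's own uniqueness hypothesis the family quantifier
collapses: for ANY fixed admissible family `μ₀` (e.g. the CEHR 2018 invariant measures of
`pinnedChain_exists_isSteadyState`), the slice `NonBallisticAtTemp ω₂ lam β γ T` is equivalent to
its instance along `μ₀` alone. -/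
theorem nonBallisticAtTemp_iff_of_family {ω₂ lam β γ T : ℝ} (hT : 0 < T)
    (μ₀ : (N : ℕ) → ℝ → ℝ → Measure (PhaseSpace N))
    (hμ₀ : ∀ (N : ℕ) (T_L T_R : ℝ), 0 < T_L → 0 < T_R →
      (pinnedChain ω₂ lam β γ).IsSteadyState N T_L T_R (μ₀ N T_L T_R)) :
    NonBallisticAtTemp ω₂ lam β γ T ↔
      ((∀ (N : ℕ) (T_L T_R : ℝ), 0 < T_L → 0 < T_R → ∀ μ ν : Measure (PhaseSpace N),
        (pinnedChain ω₂ lam β γ).IsSteadyState N T_L T_R μ →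
        (pinnedChain ω₂ lam β γ).IsSteadyState N T_L T_R ν → μ = ν) →
      ∀ D : ℕ → ℝ,
        (∀ N : ℕ, Tendsto (fun δ : ℝ =>
          (pinnedChain ω₂ lam β γ).totalCurrent (μ₀ N (T + δ / 2) (T - δ / 2)) / δ)
          (𝓝[≠] 0) (𝓝 (D N))) →
        NotBallisticSeq D) := by
  constructor
  · intro h huniq D hD
    exact h huniq μ₀ hμ₀ D hD
  · intro h huniq μ hμ D hD
    exact h huniq D fun N => response_transfer_of_unique _ huniq hμ₀ hμ hT (hD N)

end Bookkeeping

end Summit.AtomisticToContinuum.FouriersLaw.Cruxes.NonBallistic.Disproof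

end
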